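import Mathlib.Topology.MetricSpace.Lipschitz
import Mathlib.Topology.Order.Monotone
import Literature.Computability.AlgebraicComplexity.RectangularExponentBounds
import HarnessLib

/-!
# The dual exponent `α`: the supremum is attained, `{a | ω(1,a,1) = 2} = (-∞, α]`, and VXXZ 2024's `α ≥ 0.321334` is exactly the Table-1 row `ω(1, 0.321334, 1) ≤ 2` — proved

Topic `Literature/Computability/AlgebraicComplexity`; sibling of `RectangularExponent.lean` (which
defines `omegaRect K a b c = ω(a,b,c)`, `dualExponentAlpha K = α = sup {a ∈ [0,1] | ω(1,a,1) = 2}` and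
vendors the named facts `vxxz2024_omegaRect_table`, `vxxz2024_alpha_ge`), above
`RectangularExponentBounds.lean` (flattening `ω(1,1,q) ≥ 2`, the Lipschitz estimate
`ω(1,1,p) ≤ ω(1,1,q) + (p − q)`, and `ω(1,p,1) = ω(1,1,p)`), and independent of
`RectangularExponentProofs.lean` (convexity, Lotti–Romani). Everything in this file is PROVED; no new
definitions, no named facts.

## Content

* Middle placement `p ↦ ω(1,p,1)` over a field: bounded below, `ω(1,p,1) ≥ 2`, the sharper flattening
  bound `ω(1,p,1) ≥ 1 + p` (`R(⟨n, ⌈n^p⌉, n⟩) ≥ n ⌈n^p⌉`, Bläser 2013, Lemma 7.1 (2)), monotone,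
  `1`-Lipschitz (`lipschitzWith_omegaRect_one_mid_one`), continuous, and `ω(1,0,1) = 2`.
* The dual exponent: the defining supremum is a MAXIMUM, `ω(1, α, 1) = 2`
  (`omegaRect_dualExponentAlpha`, by continuity and closedness of the level set);
  `ω(1,p,1) = 2 ↔ p ≤ α` for every real `p` (`omegaRect_eq_two_iff_le_dualExponentAlpha`); hence the
  level set `{a ∈ [0,1] | ω(1,a,1) = 2}` is the interval `[0, α]`, the tree's clamped definition
  agrees with Le Gall's `α = sup {k | ω(1,1,k) = 2}` (`sSup_setOf_omegaRect_one_one_eq_two`), and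
  `α = 1 ↔ ω = 2` (`dualExponentAlpha_eq_one_iff`; "If `ω = 2`, then `α = 1`", VXXZ §1).
* **Reduction of the named fact `vxxz2024_alpha_ge` (`α ≥ 0.321334`, Vassilevska Williams–Xu–Xu–Zhou,
  SODA 2024, abstract/§1.1/§8) to one table entry**: `vxxz2024_alpha_ge ↔ ω_ℂ(1, 0.321334, 1) ≤ 2`
  (`vxxz2024_alpha_ge_iff_omegaRect_le_two`), so the fact follows from the `κ = 0.321334` row of
  `vxxz2024_omegaRect_table` with no further hypothesis (`vxxz2024_alpha_ge_of_omegaRect_table`,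
  discharging the lower-bound hypothesis of `vxxz2024_omegaRect_table.alpha_ge`), and conversely it
  yields `ω_ℂ(1, κ, 1) = 2` for every `κ ≤ 0.321334` (`vxxz2024_alpha_ge.omegaRect_eq_two`).

## What is NOT here (why `vxxz2024_alpha_ge` stays a named fact)

The remaining content of `α ≥ 0.321334` is the single inequality `ω_ℂ(1, 0.321334, 1) ≤ 2`, Table 1 of
VXXZ 2024, whose printed proof is (§3.5 Thm. 3.2, Schönhage's asymptotic sum inequality for
`ω(a,b,c)`; §3.6 `R̃(CW_q) ≤ q + 2`; §4–§7 the asymmetric-hashing laser method degenerating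
`(CW_5^{⊗4})^{⊗n}` into independent copies of `⟨m, m^κ, m⟩`; §8 a nonlinear programme solved
numerically by SQP in MATLAB/SNOPT, "the code and parameters are available at osf.io/7wgh2") a
computer-assisted optimisation whose parameters are not printed. It is not formalised here.

## References

* V. Vassilevska Williams, Y. Xu, Z. Xu, R. Zhou, *New bounds for matrix multiplication: from alpha
  to omega*, SODA 2024 = arXiv:2307.07970: abstract; §1 ("`α`, the largest constant so that
  `ω(1,α,1) = 2` … If `ω = 2`, then `α = 1`"); §1.1 Table 1; §3.5 Thm. 3.2; §8.
  [VassilevskaWilliamsXuXuZhou2024]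
* F. Le Gall, *Faster algorithms for rectangular matrix multiplication*, FOCS 2012, §1
  (`α = sup{k | ω(1,1,k) = 2}`, monotonicity/convexity of `k ↦ ω(1,1,k)`). [LeGall2012]
* M. Bläser, *Fast Matrix Multiplication*, Theory of Computing Graduate Surveys 5 (2013),
  Lemma 7.1 (2) (flattening). [Blaser2013]
* M. Christandl, F. Le Gall, V. Lysikov, J. Zuiddam, *Barriers for rectangular matrix
  multiplication*, comput. complexity 34 (2025), Rem. 3.13 (continuity of `p ↦ ω(p)`).
  [ChristandlLeGallLysikovZuiddam2025]
-/

noncomputable section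

open Filter Asymptotics

namespace Literature.Computability.AlgebraicComplexity

/-! ## The middle placement `p ↦ ω(1, p, 1)`: lower bounds, monotonicity, Lipschitz continuity -/

section Middle

variable (K : Type) [Field K]

/-- The admissible exponents of `(1, p, 1)` are bounded below (by `2`), so `ω(1,p,1) = inf …` is a
genuine infimum. [cite: Blaser2013, Lemma 7.1 (2)] -/
theorem rectAdmissibleExponents_one_mid_one_bddBelow (p : ℝ) :
    BddBelow (rectAdmissibleExponents K 1 p 1) := by
  rw [rectAdmissibleExponents_one_mid_one]
  exact rectAdmissibleExponents_one_one_bddBelow K p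

/-- **`ω(1, p, 1) ≥ 2`** for every field and every real `p` (flattening).
[cite: Blaser2013, Lemma 7.1 (2)] -/
theorem two_le_omegaRect_one_mid_one (p : ℝ) : 2 ≤ omegaRect K 1 p 1 := by
  rw [omegaRect_one_mid_one]
  exact two_le_omegaRect_one_one K p

/-- Every admissible exponent of `(1, p, 1)` is `≥ p + 1`: the flattening bound
`R(⟨n, ⌈n^p⌉, n⟩) ≥ n ⌈n^p⌉ ≥ n^{p+1}` (Bläser 2013, Lemma 7.1 (2) with Lemma 5.5) and `R = O(n^β)`
force `β ≥ p + 1`. [cite: Blaser2013, Lemma 7.1 (2)] -/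
theorem add_one_le_of_mem_rectAdmissibleExponents_one_mid_one {p β : ℝ}
    (hβ : β ∈ rectAdmissibleExponents K 1 p 1) : p + 1 ≤ β := by
  by_contra hlt
  rw [not_le] at hlt
  obtain ⟨C, hC⟩ := isBigO_iff.1 hβ
  -- eventually `n ^ (p + 1 - β) ≤ C`
  have hev : ∀ᶠ n : ℕ in atTop, (n : ℝ) ^ (p + 1 - β) ≤ C := by
    filter_upwards [hC, eventually_gt_atTop 0] with n hn hn0
    have hn0' : (0 : ℝ) < n := Nat.cast_pos.2 hn0
    rw [Real.norm_of_nonneg (Nat.cast_nonneg _),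
      Real.norm_of_nonneg (Real.rpow_nonneg (Nat.cast_nonneg _) _)] at hn
    have hflat : n * rectDim n p ≤
        tensorRank (matMulTensor K (rectDim n 1) (rectDim n p) (rectDim n 1)) := by
      haveI : NeZero n := ⟨(Nat.pos_iff_ne_zero).1 hn0⟩
      rw [tensorRank_matMulTensor_congr K (rectDim_one n) rfl (rectDim_one n)]
      exact mul_le_tensorRank_matMulTensor_left K n (rectDim n p) n
    have hceil : (n : ℝ) ^ p ≤ (rectDim n p : ℝ) := Nat.le_ceil _
    have hpow : (n : ℝ) ^ (p + 1) ≤ C * (n : ℝ) ^ β := by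
      refine le_trans ?_ hn
      calc (n : ℝ) ^ (p + 1) = (n : ℝ) ^ p * n := by rw [Real.rpow_add hn0', Real.rpow_one]
        _ ≤ (rectDim n p : ℝ) * n := by gcongr
        _ = ((n * rectDim n p : ℕ) : ℝ) := by push_cast; ring
        _ ≤ _ := by exact_mod_cast hflat
    rw [Real.rpow_sub hn0', div_le_iff₀ (Real.rpow_pos_of_pos hn0' _)]
    exact hpow
  -- but `n ^ (p + 1 - β) → ∞`
  have hlim : Tendsto (fun n : ℕ => (n : ℝ) ^ (p + 1 - β)) atTop atTop :=
    (tendsto_rpow_atTop (by linarith)).comp tendsto_natCast_atTop_atTop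
  obtain ⟨n, hn₁, hn₂⟩ := (hev.and (hlim.eventually_gt_atTop C)).exists
  exact absurd hn₁ (not_le.2 hn₂)

/-- **`ω(1, p, 1) ≥ p + 1`** for every real `p` (flattening along the `n × ⌈n^p⌉` factor; for
`p ≤ 1` the bound `ω(1,p,1) ≥ 2` of `two_le_omegaRect_one_mid_one` is better).
[cite: Blaser2013, Lemma 7.1 (2)] -/
theorem add_one_le_omegaRect_one_mid_one (p : ℝ) : p + 1 ≤ omegaRect K 1 p 1 :=
  le_csInf (rectAdmissibleExponents_nonempty K 1 p 1)
    fun _ hβ => add_one_le_of_mem_rectAdmissibleExponents_one_mid_one K hβ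

/-- **`p ↦ ω(1, p, 1)` is monotone** (zero-padding `R(⟨n,m,n⟩) ≤ R(⟨n,m',n⟩)` for `m ≤ m'`,
Bläser 2013, Lemma 5.4; the hypothesis-free form of `omegaRect_mono_middle`).
[cite: LeGall2012, §1] -/
theorem omegaRect_one_mid_one_mono {p q : ℝ} (h : p ≤ q) : omegaRect K 1 p 1 ≤ omegaRect K 1 q 1 :=
  omegaRect_mono_middle K (fun _ _ _ hm => tensorRank_matMulTensor_mono₃ K le_rfl hm le_rfl)
    (rectAdmissibleExponents_one_mid_one_bddBelow K p) h

/-- **`ω(1,p,1) ≤ ω(1,q,1) + (p − q)` for `q ≤ p`** (the Lipschitz estimate of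
`omegaRect_one_one_le_add`, transported to the middle placement).
[cite: ChristandlLeGallLysikovZuiddam2025, Rem. 3.13] -/
theorem omegaRect_one_mid_one_le_add {p q : ℝ} (hqp : q ≤ p) :
    omegaRect K 1 p 1 ≤ omegaRect K 1 q 1 + (p - q) := by
  rw [omegaRect_one_mid_one, omegaRect_one_mid_one]
  exact omegaRect_one_one_le_add K hqp

/-- **`p ↦ ω(1, p, 1)` is `1`-Lipschitz**: `|ω(1,p,1) − ω(1,q,1)| ≤ |p − q|` (monotonicity and the
one-sided estimate). [cite: ChristandlLeGallLysikovZuiddam2025, Rem. 3.13] -/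
theorem lipschitzWith_omegaRect_one_mid_one : LipschitzWith 1 fun p : ℝ => omegaRect K 1 p 1 := by
  refine LipschitzWith.of_le_add fun p q => ?_
  rcases le_total q p with hqp | hpq
  · calc omegaRect K 1 p 1 ≤ omegaRect K 1 q 1 + (p - q) := omegaRect_one_mid_one_le_add K hqp
      _ ≤ omegaRect K 1 q 1 + dist p q := by rw [Real.dist_eq]; gcongr; exact le_abs_self _
  · calc omegaRect K 1 p 1 ≤ omegaRect K 1 q 1 := omegaRect_one_mid_one_mono K hpq
      _ ≤ omegaRect K 1 q 1 + dist p q := le_add_of_nonneg_right dist_nonneg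

/-- `p ↦ ω(1, p, 1)` is continuous (Lotti–Romani 1983; the continuity invoked in CLLZ Rem. 3.13).
[cite: ChristandlLeGallLysikovZuiddam2025, Rem. 3.13] -/
theorem continuous_omegaRect_one_mid_one : Continuous fun p : ℝ => omegaRect K 1 p 1 :=
  (lipschitzWith_omegaRect_one_mid_one K).continuous

/-- **`ω(1, 0, 1) = 2`**: `R(⟨n, 1, n⟩) = n²` up to constants (standard algorithm and flattening).
[folklore] -/
theorem omegaRect_one_zero_one : omegaRect K 1 0 1 = 2 := by
  refine le_antisymm ?_ (two_le_omegaRect_one_mid_one K 0)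
  have h := omegaRect_le_max K (rectAdmissibleExponents_one_mid_one_bddBelow K 0)
  norm_num at h
  exact h

/-! ## The dual exponent `α`: the supremum is attained; the level set is an interval -/

/-- `0` lies in the level set `{a ∈ [0,1] | ω(1,a,1) = 2}` defining `α`, which is therefore
non-empty. [folklore] -/
theorem zero_mem_setOf_omegaRect_eq_two :
    (0 : ℝ) ∈ {a : ℝ | a ∈ Set.Icc (0 : ℝ) 1 ∧ omegaRect K 1 a 1 = 2} :=
  ⟨⟨le_rfl, zero_le_one⟩, omegaRect_one_zero_one K⟩

/-- The level set `{a ∈ [0,1] | ω(1,a,1) = 2}` is closed (continuity of `a ↦ ω(1,a,1)`).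
[folklore] -/
theorem isClosed_setOf_omegaRect_eq_two :
    IsClosed {a : ℝ | a ∈ Set.Icc (0 : ℝ) 1 ∧ omegaRect K 1 a 1 = 2} :=
  isClosed_Icc.inter (isClosed_eq (continuous_omegaRect_one_mid_one K) continuous_const)

/-- **The supremum defining `α` is attained: `ω(1, α, 1) = 2`** (the level set is closed, non-empty
and bounded above by `1`). [cite: LeGall2012, §1] -/
theorem omegaRect_dualExponentAlpha : omegaRect K 1 (dualExponentAlpha K) 1 = 2 :=
  ((isClosed_setOf_omegaRect_eq_two K).csSup_mem ⟨0, zero_mem_setOf_omegaRect_eq_two K⟩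
    ⟨1, fun _ ha => ha.1.2⟩).2

/-- `ω(1, p, 1) = 2` for every `p ≤ α` (monotonicity and `ω(1, α, 1) = 2`). [cite: LeGall2012, §1] -/
theorem omegaRect_eq_two_of_le_dualExponentAlpha {p : ℝ} (hp : p ≤ dualExponentAlpha K) :
    omegaRect K 1 p 1 = 2 :=
  le_antisymm ((omegaRect_one_mid_one_mono K hp).trans_eq (omegaRect_dualExponentAlpha K))
    (two_le_omegaRect_one_mid_one K p)

/-- Conversely `ω(1, p, 1) = 2` forces `p ≤ α`, for every real `p` (for `p > 1` the flattening bound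
`ω(1,p,1) ≥ p + 1 > 2` excludes the hypothesis; for `p < 0` the conclusion is `p < 0 ≤ α`).
[cite: LeGall2012, §1] -/
theorem le_dualExponentAlpha_of_omegaRect_eq_two {p : ℝ} (h : omegaRect K 1 p 1 = 2) :
    p ≤ dualExponentAlpha K := by
  rcases lt_or_ge p 0 with hp0 | hp0
  · exact hp0.le.trans (dualExponentAlpha_nonneg K)
  have hp1 : p ≤ 1 := by
    have := add_one_le_omegaRect_one_mid_one K p
    rw [h] at this
    linarith
  exact le_dualExponentAlpha K ⟨hp0, hp1⟩ h

/-- **`ω(1, p, 1) = 2 ↔ p ≤ α`**, for every field and every real `p`. [cite: LeGall2012, §1] -/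
theorem omegaRect_eq_two_iff_le_dualExponentAlpha (p : ℝ) :
    omegaRect K 1 p 1 = 2 ↔ p ≤ dualExponentAlpha K :=
  ⟨le_dualExponentAlpha_of_omegaRect_eq_two K, omegaRect_eq_two_of_le_dualExponentAlpha K⟩

/-- For `p > α` the exponent is `> 2`. [cite: LeGall2012, §1] -/
theorem two_lt_omegaRect_of_dualExponentAlpha_lt {p : ℝ} (hp : dualExponentAlpha K < p) :
    2 < omegaRect K 1 p 1 :=
  lt_of_le_of_ne (two_le_omegaRect_one_mid_one K p)
    fun h => (not_le.2 hp) ((omegaRect_eq_two_iff_le_dualExponentAlpha K p).1 h.symm)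

/-- The level set defining `α` is the interval `[0, α]`. [cite: LeGall2012, §1] -/
theorem setOf_omegaRect_eq_two_eq_Icc :
    {a : ℝ | a ∈ Set.Icc (0 : ℝ) 1 ∧ omegaRect K 1 a 1 = 2} = Set.Icc 0 (dualExponentAlpha K) := by
  ext a
  simp only [Set.mem_setOf_eq, Set.mem_Icc]
  constructor
  · rintro ⟨⟨h0, -⟩, h⟩
    exact ⟨h0, le_dualExponentAlpha_of_omegaRect_eq_two K h⟩
  · rintro ⟨h0, h⟩
    exact ⟨⟨h0, h.trans (dualExponentAlpha_le_one K)⟩, omegaRect_eq_two_of_le_dualExponentAlpha K h⟩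

/-- Without the clamp to `[0,1]`: `{p | ω(1,p,1) = 2} = (-∞, α]`. [cite: LeGall2012, §1] -/
theorem setOf_omegaRect_eq_two_eq_Iic :
    {p : ℝ | omegaRect K 1 p 1 = 2} = Set.Iic (dualExponentAlpha K) :=
  Set.ext fun p => omegaRect_eq_two_iff_le_dualExponentAlpha K p

/-- The tree's clamped definition agrees with the unclamped supremum
`sup {p | ω(1,p,1) = 2} = α`. [cite: LeGall2012, §1] -/
theorem sSup_setOf_omegaRect_eq_two :
    sSup {p : ℝ | omegaRect K 1 p 1 = 2} = dualExponentAlpha K := by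
  rw [setOf_omegaRect_eq_two_eq_Iic]
  exact csSup_Iic

/-- … and with Le Gall's literal definition in the last placement,
`α = sup {k | ω(1,1,k) = 2}` (Le Gall 2012, §1). [cite: LeGall2012, §1] -/
theorem sSup_setOf_omegaRect_one_one_eq_two :
    sSup {k : ℝ | omegaRect K 1 1 k = 2} = dualExponentAlpha K := by
  simp_rw [← omegaRect_one_mid_one]
  exact sSup_setOf_omegaRect_eq_two K

/-- **`α = 1 ↔ ω = 2`** ("If `ω = 2`, then `α = 1`. So one can view the goal of increasing `α` as
another way to attempt to prove that `ω = 2`", VXXZ §1; the converse by `ω(1, α, 1) = 2` and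
`ω(1,1,1) = ω`). [cite: VassilevskaWilliamsXuXuZhou2024, §1] -/
theorem dualExponentAlpha_eq_one_iff : dualExponentAlpha K = 1 ↔ omega K = 2 := by
  constructor
  · intro h
    have h2 := omegaRect_dualExponentAlpha K
    rwa [h, omegaRect_one_one_one] at h2
  · intro h
    refine le_antisymm (dualExponentAlpha_le_one K) (le_dualExponentAlpha_of_omegaRect_eq_two K ?_)
    rw [omegaRect_one_one_one]
    exact h

end Middle

/-! ## VXXZ 2024, `α ≥ 0.321334`: reduction to the Table-1 row `ω(1, 0.321334, 1) ≤ 2` -/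

section VXXZ

/-- **`α ≥ 0.321334` is equivalent to `ω_ℂ(1, 0.321334, 1) = 2`** (`ω(1,p,1) = 2 ↔ p ≤ α`).
[cite: VassilevskaWilliamsXuXuZhou2024, abstract and §1.1] -/
theorem vxxz2024_alpha_ge_iff_omegaRect_eq_two :
    vxxz2024_alpha_ge ↔ omegaRect ℂ 1 0.321334 1 = 2 :=
  (omegaRect_eq_two_iff_le_dualExponentAlpha ℂ 0.321334).symm

/-- **`α ≥ 0.321334` is equivalent to the single Table-1 entry `ω_ℂ(1, 0.321334, 1) ≤ 2`** (the
lower bound `≥ 2` is flattening). This upper bound — the `κ = 0.321334` row of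
`vxxz2024_omegaRect_table`, a computer-assisted laser-method optimisation (§8) — is the entire
unproved content of the named fact `vxxz2024_alpha_ge`.
[cite: VassilevskaWilliamsXuXuZhou2024, §1.1 Table 1 and §8] -/
theorem vxxz2024_alpha_ge_iff_omegaRect_le_two :
    vxxz2024_alpha_ge ↔ omegaRect ℂ 1 0.321334 1 ≤ 2 := by
  rw [vxxz2024_alpha_ge_iff_omegaRect_eq_two]
  exact ⟨le_of_eq, fun h => le_antisymm h (two_le_omegaRect_one_mid_one ℂ _)⟩

/-- **Table 1 of VXXZ 2024 implies `α ≥ 0.321334`**, with no further hypothesis (the lower bound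
`ω(1, 0.321334, 1) ≥ 2` required by `vxxz2024_omegaRect_table.alpha_ge` is discharged by flattening).
[cite: VassilevskaWilliamsXuXuZhou2024, §1.1 Table 1] -/
theorem vxxz2024_alpha_ge_of_omegaRect_table (h : vxxz2024_omegaRect_table) : vxxz2024_alpha_ge :=
  vxxz2024_alpha_ge_iff_omegaRect_le_two.2 h.alpha_row

/-- Consequence of `α ≥ 0.321334`: `ω_ℂ(1, κ, 1) = 2` for every `κ ≤ 0.321334` (rectangular
products `n × n^κ` by `n^κ × n` in `n^{2+o(1)}` operations).
[cite: VassilevskaWilliamsXuXuZhou2024, abstract and §1.1] -/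
theorem vxxz2024_alpha_ge.omegaRect_eq_two (h : vxxz2024_alpha_ge) {κ : ℝ} (hκ : κ ≤ 0.321334) :
    omegaRect ℂ 1 κ 1 = 2 :=
  omegaRect_eq_two_of_le_dualExponentAlpha ℂ (hκ.trans h)

/-- … and in the last placement, `ω_ℂ(1, 1, κ) = 2` for `κ ≤ 0.321334`.
[cite: VassilevskaWilliamsXuXuZhou2024, abstract and §1.1] -/
theorem vxxz2024_alpha_ge.omegaRect_one_one_eq_two (h : vxxz2024_alpha_ge) {κ : ℝ}
    (hκ : κ ≤ 0.321334) : omegaRect ℂ 1 1 κ = 2 := by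
  rw [← omegaRect_one_mid_one]
  exact h.omegaRect_eq_two hκ

end VXXZ

end Literature.Computability.AlgebraicComplexity

end
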